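import Summits.CriticalPhenomena.PercolationContinuityZ3.Theorems.Transplant.SkelPhiInfClusterMeets
import Summits.CriticalPhenomena.PercolationContinuityZ3.Theorems.Transplant.SkelPhiQStepsN
import HarnessLib

/-!
# WAVE-Q binder row «SkelPhiInfClusterMeets» ↦ «SkelPhiInfClusterMeetsQ» (quasi-step rung (N3-b); WAVE-Q-BINDER-rows-v0.6.tsv, captain gen-1 g4): **every infinite cluster meets
# every region holding far boxes, a.s. — under EXACT-FOOTPRINT QUASI-STEPS of the chart** (`Frames` + `QStepsN M` + `Lip`)

builds on p205010 (kernel theorem, internal audit signed; external expert review pending) — nothing in this file uses p205010; nothing here is a claim about any open node.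
Lane `prim-bschramm`, seat `prim-bschramm-stmt` gen 33 (port pen; captain's table v0.6, truly-portable level-1 row taken per bus 2026-08-27 07:32Z).  Helper file
(`--supports stmt-CriticalPhenomena-4575 --as helper`); def-free; the `Steps ↦ QStepsN M` twins of «SkelPhiInfClusterMeets» §5–§6 (p4; the five declarations that
thread `hstep`): hunk (i) `(hstep : Steps G φ) ↦ {M : ℕ} (hq : Skelφ.QStepsN G φ M)`, hunk (ii) `exists_mem_graphBall_φ_eq hstep ↦ QStepsN.exists_mem_graphBall_eq hq` — the
distance is DISCARDED in `farBalls_of_farBoxes` (only a vertex over the box centre is needed), so NO radius token moves; §1–§5's Steps-free declarations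
(`InfClusterMeets.*`, `FarBoxes`, `quadrant`, `halfPlane`, `farBoxes_*`) stay imported from the original; the `PlanarSkeletonNeg` instances of its §7 belong to N1 and are not
twinned.  Regression: at `M = 1` (`qStepsN_of_steps`) each statement is the original's.
* `farBalls_of_farBoxesQ`, `ae_reachable_of_farBoxesQ`, `ae_exit_of_farBoxesQ`, `ae_forall_quadrant_reachableQ`, `ae_forall_halfPlane_reachableQ`.
[cite: MartineauTassion2017, §3.1.2 Lemma 3.4, §3.2 (13) and proof of Lemma 3.5 (arXiv pp. 9–10)] [cite: KozmaNitzan2024, §4 p. 20 ((22)–(23))]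
-/

noncomputable section

namespace Summit.CriticalPhenomena.PercolationContinuityZ3.Theorems.Transplant

namespace Skelφ

open MeasureTheory Literature.Probability.Percolation Literature.Probability.LatticeModels SimpleGraph
open Literature.Barriers.CriticalPhenomena (graphBall)

variable {V : Type} {G : SimpleGraph V} {φ : V → Site 2} {types : Finset V}

/-- **Far boxes hold far balls under `QStepsN`** (`Frames` + `QStepsN M` + `Lip`, any anchor vertex `w₀`): the box centre `y` is `φ v` for a quasi-step-reachable vertex `v`,
`v = α t` for its frame, and `B_G(α t, m) ⊆ φ⁻¹(φ v + Λ_m)` because `φ` is `1`-Lipschitz. [cite: KozmaNitzan2024, §4 p. 20 ((22)–(23))] -/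
theorem farBalls_of_farBoxesQ (hfr : Frames G φ types) {M : ℕ} (hq : QStepsN G φ M) (hlip : Lip G φ) (w₀ : V) {Q : Set V} (hQ : FarBoxes φ Q) :
    InfClusterMeets.FarBalls G types Q := by
  intro m
  obtain ⟨y, hy⟩ := hQ m
  obtain ⟨v, -, hφv⟩ := QStepsN.exists_mem_graphBall_eq hq w₀ y
  obtain ⟨t, ht, α, hαt, -⟩ := hfr v
  refine ⟨t, ht, α, fun w hw => hy w ?_⟩
  rw [hαt] at hw
  rw [mem_box]
  intro i
  have h := abs_sub_le_of_mem_graphBall hlip hw i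
  rw [hφv] at h
  simp only [Pi.sub_apply]
  exact abs_le.1 h

/-- **Every infinite cluster meets every region holding far boxes, a.s.** — quasi-step form. [cite: MartineauTassion2017, §3.1.2 Lemma 3.4 (second part; arXiv p. 9)] -/
theorem ae_reachable_of_farBoxesQ [Countable V] (hc : G.Preconnected) (hfr : Frames G φ types) {M : ℕ} (hq : QStepsN G φ M) (hlip : Lip G φ) (w₀ : V)
    {p : unitInterval} (hU : ∀ᵐ ω ∂bondPercolation G p, numInfiniteClusters ω ≤ 1) {Q : Set V} (hQ : FarBoxes φ Q) :
    ∀ᵐ ω ∂bondPercolation G p, ∀ x : V, ω ∈ percolatesAt x → ∃ q ∈ Q, ω ∈ percolatesAt q ∧ (openGraph ω).Reachable x q :=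
  InfClusterMeets.ae_reachable_of_farBalls hc hU (farBalls_of_farBoxesQ hfr hq hlip w₀ hQ)

/-- **First-exit form** — quasi-step form. [cite: MartineauTassion2017, §3.2 (13) (arXiv p. 10), §3.1.1 Lemma 3.1 (arXiv p. 8)] -/
theorem ae_exit_of_farBoxesQ [Countable V] (hc : G.Preconnected) (hfr : Frames G φ types) {M : ℕ} (hq : QStepsN G φ M) (hlip : Lip G φ) (w₀ : V)
    {p : unitInterval} (hU : ∀ᵐ ω ∂bondPercolation G p, numInfiniteClusters ω ≤ 1) {X : Set V} (hX : FarBoxes φ Xᶜ) :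
    ∀ᵐ ω ∂bondPercolation G p, ∀ x ∈ X, ω ∈ percolatesAt x →
      ∃ z ∈ X, ∃ u, u ∉ X ∧ G.Adj z u ∧ (openGraph ω).Adj z u ∧ ω ∈ openConnIn X x z :=
  InfClusterMeets.ae_exit_of_farBalls hc hU (farBalls_of_farBoxesQ hfr hq hlip w₀ hX)

/-- **All quadrants at once** — quasi-step form. [cite: MartineauTassion2017, §3.2 proof of Lemma 3.5, (13) and Fact 2 (arXiv p. 10)] -/
theorem ae_forall_quadrant_reachableQ [Countable V] (hc : G.Preconnected) (hfr : Frames G φ types) {M : ℕ} (hq : QStepsN G φ M) (hlip : Lip G φ)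
    (t : V) {p : unitInterval} (hU : ∀ᵐ ω ∂bondPercolation G p, numInfiniteClusters ω ≤ 1) :
    ∀ᵐ ω ∂bondPercolation G p, ∀ (σ : Fin 2 → ℤˣ) (a : Fin 2 → ℤ) (x : V), ω ∈ percolatesAt x →
      ∃ q ∈ quadrant φ t σ a, ω ∈ percolatesAt q ∧ (openGraph ω).Reachable x q := by
  have h : ∀ σa : (Fin 2 → ℤˣ) × (Fin 2 → ℤ), ∀ᵐ ω ∂bondPercolation G p, ∀ x : V, ω ∈ percolatesAt x →
      ∃ q ∈ quadrant φ t σa.1 σa.2, ω ∈ percolatesAt q ∧ (openGraph ω).Reachable x q :=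
    fun σa => ae_reachable_of_farBoxesQ hc hfr hq hlip t hU (farBoxes_quadrant t σa.1 σa.2)
  have h' := ae_all_iff.2 h
  filter_upwards [h'] with ω hω σ a x hx
  exact hω (σ, a) x hx

/-- **All half-planes at once** — quasi-step form. [cite: MartineauTassion2017, §3.2 proof of Lemma 3.5, Fact 2 (arXiv p. 10: V ∖ Y)] -/
theorem ae_forall_halfPlane_reachableQ [Countable V] (hc : G.Preconnected) (hfr : Frames G φ types) {M : ℕ} (hq : QStepsN G φ M) (hlip : Lip G φ)
    (t : V) {p : unitInterval} (hU : ∀ᵐ ω ∂bondPercolation G p, numInfiniteClusters ω ≤ 1) :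
    ∀ᵐ ω ∂bondPercolation G p, ∀ (i : Fin 2) (σ : ℤˣ) (a : ℤ) (x : V), ω ∈ percolatesAt x →
      ∃ q ∈ halfPlane φ t i σ a, ω ∈ percolatesAt q ∧ (openGraph ω).Reachable x q := by
  filter_upwards [ae_forall_quadrant_reachableQ hc hfr hq hlip t hU] with ω hω i σ a x hx
  obtain ⟨q, hqd, hperc, hxq⟩ := hω (fun _ => σ) (fun _ => a) x hx
  exact ⟨q, quadrant_subset_halfPlane t _ _ i hqd, hperc, hxq⟩

end Skelφ

end Summit.CriticalPhenomena.PercolationContinuityZ3.Theorems.Transplant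

end
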